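import Literature.Analysis.FluidPDE.TrilinearBlockExpansion

/-!
# Strain-currency pairing lemmas for the difference of two flows on the whole space
# (levels 0 and 1: the trilinear terms see only the symmetric part of the reference gradient)

Cell `ns-blowup`, seat `ns-palasek-19179-p2` (g6; holder-of-record lineage of crux
stmt-NavierStokesRegularity-19179 `EpisodeBase`, route `PalasekTowerBreakdown`; `--supports
stmt-NavierStokesRegularity-19179`). Support lemmas for the registered-able stub `stub_strain_door : StrainDoor`
of the strategist line `Cruxes/EpisodeBase/Lines/straindoor.lean` (cstrat-19179, v2): the a-posteriori door
whose Grönwall rate is the SYMMETRIC GRADIENT of the reference. LABEL: E–C analysis (KERNEL: theorems only; no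
definition, no named fact, no `sorry`; register-free — an arbitrary finite-dimensional inner product space `E`).
WHAT THIS IS NOT: not Navier–Stokes evidence — whole-space calculus identities and bounds for two given fields;
no flow, run, design or blow-up is exhibited or asserted.

## What is proved (all fields on a finite-dimensional real inner product space `E`, Lebesgue measure)

Throughout `u : E → E` is the REFERENCE (bounded with bounded derivatives, `HasBoundedDerivs`; divergence
free where stated) and `v` the DIFFERENCE (a smooth `L²` field, `IsSmoothL2Field`); the STRAIN MAJORANT is the
hypothesis `∀ x ξ, |⟪Du(x) ξ, ξ⟫| ≤ σ ‖ξ‖²` (a bound on the quadratic form of the full gradient, i.e. on its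
symmetric part only), exactly the field `strain` of `StrainBudgetOn`.

* `abs_sum_inner_comp_le_of_quadForm_le` — the linear-algebra heart: for `A : E →L E` with
  `|⟪A ξ, ξ⟫| ≤ σ‖ξ‖²` and ANY `T : E →L E'`, `|∑ₖ ⟪T (A bₖ), T bₖ⟫| ≤ σ ∑ₖ ‖T bₖ‖²` over an orthonormal
  basis `b` (`∑ₖ ⟪T A bₖ, T bₖ⟫ = ∑ⱼ ⟪A gⱼ, gⱼ⟫` with `gⱼ = Tᵀ cⱼ`: the trace pairing `tr(A · TᵀT)` sees only
  `sym A` because `TᵀT` is symmetric positive semidefinite).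
* `abs_integral_inner_convect_le_of_strain` (level 0, stretching) — `|∫ ⟪(v·∇)u, v⟫| ≤ σ ∫ ‖v‖²`.
  (Level 0, transport, `∫ ⟪v, (u·∇)v⟫ = 0` for `div u = 0`, is the tree's
  `Literature.Analysis.FluidPDE.integral_inner_convect_eq_zero`.)
* `integral_inner_fderiv_apply_eq_neg` — whole-space integration by parts for two `C¹` fields with the
  three pairings in `L¹`: `∫ ⟪F, ∂ₑG⟫ = −∫ ⟪∂ₑF, G⟫`.
* `integral_inner_convect_laplacian_eq_neg_sum` (level 1, transport IDENTITY) — for `div u = 0`: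
  `∫ ⟪(u·∇)v, Δv⟫ = −∑ₖ ∫ ⟪Dv (Du bₖ), Dv bₖ⟫` (one integration by parts per coordinate; the term
  `⟪(u·∇)∂ₖv, ∂ₖv⟫` integrates to zero by skewness of transport).
* `abs_integral_inner_convect_laplacian_le_of_strain` (level 1, transport BOUND) —
  `|∫ ⟪(u·∇)v, Δv⟫| ≤ σ ∑ₖ ∫ ‖∂ₖv‖²`: NO `‖u‖_∞`, NO `‖Du‖_∞`, only the strain majorant.
* (Part II, `PalasekTowerBreakdownEpisodeBaseStrainPairingStretching.lean`: the level-1 STRETCHING identity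
  `∫ ⟪(v·∇)u, Δv⟫ = −∑ₖ ∫ ⟪Du (∂ₖv), ∂ₖv⟫ − ∑ₖ ∫ ⟪D²u (bₖ) (v), ∂ₖv⟫` and its bound
  `≤ σ ∑ₖ ∫ ‖∂ₖv‖² + σ₂ ∫ ‖v‖ ∑ₖ ‖∂ₖv‖`.)

These are the `L²`- and `H¹`-level coefficients `2σ`, `4σ (+ σ₂ cross term)` of the strain-currency energy
inequality for `w̃ = v − w` between a free run `v` and a pseudo-run `w` (Serrin's energy method: the linear
term of the perturbation energy is `−∫ w̃·D·w̃` with `D = sym ∇w`; Doering–Gibbon 1995 §2.3 eq. (2.3.29)–(2.3.31);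
at the `H¹` level Constantin–Foias 1988 Ch. 10 with the trilinear forms rewritten against `sym ∇w`).

References: C. R. Doering, J. D. Gibbon, *Applied Analysis of the Navier–Stokes Equations*, CUP 1995, §2.3
[cite: DoeringGibbon1995, §2.3 (2.3.29)–(2.3.31)]; P. Constantin, C. Foias, *Navier–Stokes Equations*, Univ.
Chicago Press 1988, Ch. 10 [cite: ConstantinFoiasNSE1988, Ch. 10 Thm. 10.2]; A. Cheskidov, M. Dai,
arXiv:1507.06611 §3.1 (skewness of transport on the whole space) [cite: CheskidovDai2015, §3.1].
-/

noncomputable section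

set_option linter.dupNamespace false

open MeasureTheory Filter Function Set
open scoped ENNReal NNReal RealInnerProductSpace Topology Laplacian
open Literature.Analysis.FunctionSpaces Literature.Analysis.FluidPDE

namespace Summit.NavierStokesRegularity.NavierStokesRegularity.Theorems.StrainPairing

variable {E : Type*} [NormedAddCommGroup E] [InnerProductSpace ℝ E] [FiniteDimensional ℝ E]
variable {E' : Type*} [NormedAddCommGroup E'] [InnerProductSpace ℝ E'] [FiniteDimensional ℝ E']

/-! ## §1 Linear algebra: a trace pairing sees only the symmetric part -/

section LinearAlgebra

omit [FiniteDimensional ℝ E] in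
/-- **The trace pairing `∑ₖ ⟪T A bₖ, T bₖ⟫` sees only the quadratic form of `A`.** If
`|⟪A ξ, ξ⟫| ≤ σ ‖ξ‖²` for all `ξ`, then for every continuous linear `T : E → E'` and every orthonormal basis
`b` of `E`, `|∑ₖ ⟪T (A bₖ), T bₖ⟫| ≤ σ ∑ₖ ‖T bₖ‖²`. Proof: with an orthonormal basis `c` of `E'` and
`gⱼ := ∑ₖ ⟪T bₖ, cⱼ⟫ bₖ` (so that `⟪T y, cⱼ⟫ = ⟪y, gⱼ⟫`), `∑ₖ ⟪T A bₖ, T bₖ⟫ = ∑ⱼ ⟪A gⱼ, gⱼ⟫` and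
`∑ₖ ‖T bₖ‖² = ∑ⱼ ‖gⱼ‖²`. [cite: DoeringGibbon1995, §2.3 (2.3.29)–(2.3.31)] -/
theorem abs_sum_inner_comp_le_of_quadForm_le {ι : Type*} [Fintype ι] (b : OrthonormalBasis ι ℝ E)
    (A : E →L[ℝ] E) (T : E →L[ℝ] E') {σ : ℝ} (hA : ∀ ξ : E, |⟪A ξ, ξ⟫| ≤ σ * ‖ξ‖ ^ 2) :
    |∑ k, ⟪T (A (b k)), T (b k)⟫| ≤ σ * ∑ k, ‖T (b k)‖ ^ 2 := by
  classical
  set c := stdOrthonormalBasis ℝ E' with hc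
  -- the vectors `g j = Tᵀ c_j`, written in the basis `b`
  set g : Fin (Module.finrank ℝ E') → E := fun j => ∑ k, ⟪T (b k), c j⟫ • b k with hg
  -- `⟪T y, c j⟫ = ⟪y, g j⟫`
  have hadj : ∀ (y : E) (j : Fin (Module.finrank ℝ E')), ⟪T y, c j⟫ = ⟪y, g j⟫ := by
    intro y j
    conv_lhs => rw [← b.sum_repr' y]
    simp only [map_sum, map_smul, sum_inner, inner_smul_left, hg, inner_sum, inner_smul_right,
      RCLike.conj_to_real]
    exact Finset.sum_congr rfl fun k _ => by rw [real_inner_comm (b k) y]; ring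
  -- expand each summand in the basis `c`
  have hterm : ∀ k, ⟪T (A (b k)), T (b k)⟫ = ∑ j, ⟪A (b k), g j⟫ * ⟪b k, g j⟫ := by
    intro k
    rw [← c.sum_inner_mul_inner (T (A (b k))) (T (b k))]
    refine Finset.sum_congr rfl fun j _ => ?_
    rw [hadj, real_inner_comm (T (b k)) (c j), hadj]
  -- resum: `∑ₖ ⟪A bₖ, gⱼ⟫ ⟪bₖ, gⱼ⟫ = ⟪A gⱼ, gⱼ⟫`
  have hcol : ∀ j, ∑ k, ⟪A (b k), g j⟫ * ⟪b k, g j⟫ = ⟪A (g j), g j⟫ := by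
    intro j
    have h1 : A (g j) = ∑ k, ⟪b k, g j⟫ • A (b k) := by
      conv_lhs => rw [← b.sum_repr' (g j)]
      simp only [map_sum, map_smul]
    rw [h1, sum_inner]
    exact Finset.sum_congr rfl fun k _ => by rw [real_inner_smul_left]; ring
  have hsum : ∑ k, ⟪T (A (b k)), T (b k)⟫ = ∑ j, ⟪A (g j), g j⟫ := by
    simp_rw [hterm]
    rw [Finset.sum_comm]
    exact Finset.sum_congr rfl fun j _ => hcol j
  -- the norms: `∑ₖ ‖T bₖ‖² = ∑ⱼ ‖gⱼ‖²`
  have hgnorm : ∀ j, ‖g j‖ ^ 2 = ∑ k, ⟪T (b k), c j⟫ ^ 2 := by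
    intro j
    rw [← b.sum_sq_inner_right (g j)]
    exact Finset.sum_congr rfl fun k _ => by rw [hadj]
  have hnorm : ∑ k, ‖T (b k)‖ ^ 2 = ∑ j, ‖g j‖ ^ 2 := by
    simp_rw [hgnorm]
    rw [Finset.sum_comm]
    exact Finset.sum_congr rfl fun k _ => (c.sum_sq_inner_left (T (b k))).symm
  rw [hsum, hnorm, Finset.mul_sum]
  exact (Finset.abs_sum_le_sum_abs _ _).trans (Finset.sum_le_sum fun j _ => hA (g j))

end LinearAlgebra

/-! ## §2 Level 0: the stretching term against the field itself -/

section LevelZero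

variable [MeasurableSpace E] [BorelSpace E]

/-- **Level 0, stretching**: `|∫ ⟪(v·∇)u, v⟫| ≤ σ ∫ ‖v‖²` for a smooth `L²` field `v` and a reference `u`
whose gradient has quadratic form bounded by `σ` (`(v·∇)u (x) = Du(x) (v x)`, so the integrand is the
quadratic form itself). [cite: DoeringGibbon1995, §2.3 (2.3.29)–(2.3.31)] -/
theorem abs_integral_inner_convect_le_of_strain {u v : E → E} (hv : IsSmoothL2Field v) {σ : ℝ}
    (hσ : ∀ x ξ : E, |⟪fderiv ℝ u x ξ, ξ⟫| ≤ σ * ‖ξ‖ ^ 2) :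
    |∫ x, ⟪convect v u x, v x⟫| ≤ σ * ∫ x, ‖v x‖ ^ 2 := by
  have hi : Integrable (fun x => ‖v x‖ ^ 2) volume := by
    have := integrable_inner_of_memLp_two hv.memLp_two hv.memLp_two
    refine this.congr (Eventually.of_forall fun x => ?_)
    simp only [real_inner_self_eq_norm_sq]
  calc |∫ x, ⟪convect v u x, v x⟫| ≤ ∫ x, |⟪convect v u x, v x⟫| :=
        abs_integral_le_integral_abs
    _ ≤ ∫ x, σ * ‖v x‖ ^ 2 := by
        refine integral_mono_of_nonneg (Eventually.of_forall fun x => abs_nonneg _) (hi.const_mul σ)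
          (Eventually.of_forall fun x => ?_)
        simp only [convect_apply]
        exact hσ x (v x)
    _ = σ * ∫ x, ‖v x‖ ^ 2 := integral_const_mul _ _

end LevelZero

/-! ## §3 Whole-space integration by parts for two `C¹` fields -/

section IBP

variable [MeasurableSpace E] [BorelSpace E]

omit [FiniteDimensional ℝ E'] in
/-- **`∫ ⟪F, ∂ₑG⟫ = −∫ ⟪∂ₑF, G⟫`** for `C¹` fields `F, G : E → E'` whose three pairings `⟪∂ₑF, G⟫`,
`⟪F, ∂ₑG⟫`, `⟪F, G⟫` are integrable (Mathlib's `integral_bilinear_hasFDerivAt_right_eq_neg_left_of_integrable`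
with the inner product; no boundary terms on the whole space). [cite: CheskidovDai2015, §3.1] -/
theorem integral_inner_fderiv_apply_eq_neg {F G : E → E'} (hF : ContDiff ℝ 1 F) (hG : ContDiff ℝ 1 G) (e : E)
    (h₁ : Integrable (fun x => ⟪fderiv ℝ F x e, G x⟫) volume)
    (h₂ : Integrable (fun x => ⟪F x, fderiv ℝ G x e⟫) volume)
    (h₃ : Integrable (fun x => ⟪F x, G x⟫) volume) :
    ∫ x, ⟪F x, fderiv ℝ G x e⟫ = -∫ x, ⟪fderiv ℝ F x e, G x⟫ :=
  integral_bilinear_hasFDerivAt_right_eq_neg_left_of_integrable (μ := (volume : Measure E))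
    (B := innerSL ℝ (E := E')) (f := F) (f' := fderiv ℝ F) (g := G) (g' := fderiv ℝ G) (v := e)
    h₁ h₂ h₃ (fun x _ => (hF.differentiable one_ne_zero x).hasFDerivAt)
    (fun x _ => (hG.differentiable one_ne_zero x).hasFDerivAt)

end IBP

/-! ## §4 Level 1: the transport term against the Laplacian -/

section LevelOne

variable [MeasurableSpace E] [BorelSpace E]

/-- The full derivative of a smooth `L²` field is in `L²` (as a field of continuous linear maps).
[cite: CheskidovDai2015, §3.1] -/
theorem memLp_fderiv_two {v : E → E'} (hv : IsSmoothL2Field v) : MemLp (fderiv ℝ v) 2 volume := by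
  have hg : MemLp (iteratedFDeriv ℝ 1 v) 2 volume :=
    ⟨(hv.contDiff.continuous_iteratedFDeriv (mod_cast le_top)).aestronglyMeasurable,
      hv.eLpNorm_iteratedFDeriv_lt_top 1⟩
  refine hg.of_le ((hv.contDiff_nat 1).continuous_fderiv one_ne_zero).aestronglyMeasurable
    (Eventually.of_forall fun x => ?_)
  rw [norm_iteratedFDeriv_one]


omit [FiniteDimensional ℝ E] [FiniteDimensional ℝ E'] [MeasurableSpace E] [BorelSpace E] in
/-- The derivative of the convective term: `∂ₑ[(u·∇)v] = Dv (Du e) + (u·∇)(∂ₑ v)` for `C²` `v` and `C¹` `u`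
(product rule `fderiv_clm_apply` and symmetry of second derivatives). [cite: CheskidovDai2015, §3.1] -/
theorem fderiv_convect_apply {u : E → E} {v : E → E'} (hu : ContDiff ℝ 1 u) (hv : ContDiff ℝ 2 v)
    (x e : E) :
    fderiv ℝ (convect u v) x e =
      fderiv ℝ v x (fderiv ℝ u x e) + fderiv ℝ (fun y => fderiv ℝ v y e) x (u x) := by
  have hdv : DifferentiableAt ℝ (fderiv ℝ v) x :=
    ((hv.fderiv_right (m := 1) le_rfl).differentiable one_ne_zero) x
  have hdu : DifferentiableAt ℝ u x := (hu.differentiable one_ne_zero) x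
  have hconv : convect u v = fun y => (fderiv ℝ v y) (u y) := by funext y; rfl
  rw [hconv, fderiv_clm_apply hdv hdu]
  simp only [add_apply, ContinuousLinearMap.coe_comp, Function.comp_apply,
    ContinuousLinearMap.flip_apply]
  congr 1
  -- `D²v(x) e (u x) = D²v(x) (u x) e = ∂_{u x} (∂ₑ v)`
  have hsymm : IsSymmSndFDerivAt ℝ v x :=
    (hv.contDiffAt (x := x)).isSymmSndFDerivAt (by simp)
  rw [hsymm e (u x), fderiv_clm_apply hdv (differentiableAt_const e)]
  simp

/-- **Level 1, transport IDENTITY.** For a divergence-free reference `u` with bounded derivatives and a smooth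
`L²` field `v`: `∫ ⟪(u·∇)v, Δv⟫ = −∑ₖ ∫ ⟪Dv (Du bₖ), ∂ₖv⟫` (`b` the standard orthonormal basis): write
`Δv = ∑ₖ ∂ₖ∂ₖv`, integrate by parts once in each coordinate, expand `∂ₖ[(u·∇)v] = Dv(Du bₖ) + (u·∇)∂ₖv`, and
drop `∫ ⟪(u·∇)∂ₖv, ∂ₖv⟫ = 0` (skewness of transport, `integral_inner_convect_eq_zero`).
[cite: ConstantinFoiasNSE1988, Ch. 10 Thm. 10.2] -/
theorem integral_inner_convect_laplacian_eq_neg_sum {u : E → E} {v : E → E'} (hu : HasBoundedDerivs u)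
    (hdiv : VectorCalculus.IsDivFree u) (hv : IsSmoothL2Field v) :
    ∫ x, ⟪convect u v x, (Δ v) x⟫ =
      -∑ k, ∫ x, ⟪fderiv ℝ v x (fderiv ℝ u x (stdOrthonormalBasis ℝ E k)),
        fderiv ℝ v x (stdOrthonormalBasis ℝ E k)⟫ := by
  set b := stdOrthonormalBasis ℝ E with hb
  have hcv : IsSmoothL2Field (convect u v) := hv.convect hu
  have hu1 : ContDiff ℝ 1 u := hu.contDiff_nat 1
  have hv2 : ContDiff ℝ 2 v := hv.contDiff_nat 2
  obtain ⟨M₁, hM₁⟩ := hu.exists_norm_fderiv_le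
  -- the `k`-th term
  have hk : ∀ k, ∫ x, ⟪convect u v x, fderiv ℝ (fun y => fderiv ℝ v y (b k)) x (b k)⟫ =
      -∫ x, ⟪fderiv ℝ v x (fderiv ℝ u x (b k)), fderiv ℝ v x (b k)⟫ := by
    intro k
    set G : E → E' := fun y => fderiv ℝ v y (b k) with hG
    have hGS : IsSmoothL2Field G := hv.fderiv_apply (b k)
    -- integration by parts
    have h₁ : Integrable (fun x => ⟪fderiv ℝ (convect u v) x (b k), G x⟫) volume :=
      integrable_inner_of_memLp_two (hcv.memLp_fderiv_apply (b k)) hGS.memLp_two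
    have h₂ : Integrable (fun x => ⟪convect u v x, fderiv ℝ G x (b k)⟫) volume :=
      integrable_inner_of_memLp_two hcv.memLp_two (hGS.memLp_fderiv_apply (b k))
    have h₃ : Integrable (fun x => ⟪convect u v x, G x⟫) volume :=
      integrable_inner_of_memLp_two hcv.memLp_two hGS.memLp_two
    rw [integral_inner_fderiv_apply_eq_neg (hcv.contDiff_nat 1) (hGS.contDiff_nat 1) (b k) h₁ h₂ h₃]
    -- expand the derivative of the convective term
    have hexp : ∀ x, ⟪fderiv ℝ (convect u v) x (b k), G x⟫ =
        ⟪fderiv ℝ v x (fderiv ℝ u x (b k)), fderiv ℝ v x (b k)⟫ + ⟪G x, convect u G x⟫ := by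
      intro x
      rw [fderiv_convect_apply hu1 hv2 x (b k), inner_add_left]
      congr 1
      exact real_inner_comm _ _
    simp_rw [hexp]
    have i₁ : Integrable (fun x => ⟪fderiv ℝ v x (fderiv ℝ u x (b k)), fderiv ℝ v x (b k)⟫) volume := by
      -- `‖Dv (Du bₖ)‖ ≤ M₁ ‖Dv‖`, an `L²` function, against `∂ₖ v ∈ L²`
      have hm : MemLp (fun x => fderiv ℝ v x (fderiv ℝ u x (b k))) 2 volume := by
        refine MemLp.of_le_mul (c := M₁) (memLp_fderiv_two hv) ?_ (Eventually.of_forall fun x => ?_)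
        · exact ((hv2.continuous_fderiv (by norm_num)).clm_apply
            ((hu1.continuous_fderiv one_ne_zero).clm_apply continuous_const)).aestronglyMeasurable
        · calc ‖fderiv ℝ v x (fderiv ℝ u x (b k))‖ ≤ ‖fderiv ℝ v x‖ * ‖fderiv ℝ u x (b k)‖ :=
              ContinuousLinearMap.le_opNorm _ _
            _ ≤ ‖fderiv ℝ v x‖ * (‖fderiv ℝ u x‖ * ‖b k‖) := by
              gcongr; exact ContinuousLinearMap.le_opNorm _ _
            _ ≤ M₁ * ‖fderiv ℝ v x‖ := by
              rw [b.orthonormal.1 k, mul_one, mul_comm]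
              exact mul_le_mul_of_nonneg_right (hM₁ x) (norm_nonneg _)
      exact integrable_inner_of_memLp_two hm hGS.memLp_two
    have i₂ : Integrable (fun x => ⟪G x, convect u G x⟫) volume :=
      integrable_inner_of_memLp_two hGS.memLp_two (hGS.convect hu).memLp_two
    rw [integral_add i₁ i₂, integral_inner_convect_eq_zero hu hdiv hGS, add_zero]
  -- sum over `k`
  have hrep : ∀ x, ⟪convect u v x, (Δ v) x⟫ =
      ∑ k, ⟪convect u v x, fderiv ℝ (fun y => fderiv ℝ v y (b k)) x (b k)⟫ := by
    intro x
    rw [laplacian_eq_sum_fderiv_fderiv b hv2 x, inner_sum]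
  simp_rw [hrep]
  rw [integral_finsetSum _ fun k _ => ?_]
  · rw [← Finset.sum_neg_distrib]
    exact Finset.sum_congr rfl fun k _ => hk k
  · exact integrable_inner_of_memLp_two hcv.memLp_two
      ((hv.fderiv_apply (b k)).memLp_fderiv_apply (b k))

/-- **Level 1, transport BOUND in strain currency.** For a divergence-free reference `u` with bounded
derivatives whose gradient has quadratic form bounded by `σ`, and a smooth `L²` field `v`:
`|∫ ⟪(u·∇)v, Δv⟫| ≤ σ ∑ₖ ∫ ‖∂ₖv‖²` — the transport term against the Laplacian costs the STRAIN of `u`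
only (no `‖u‖_∞`, no `‖Du‖_∞`). [cite: DoeringGibbon1995, §2.3 (2.3.29)–(2.3.31)]
[cite: ConstantinFoiasNSE1988, Ch. 10 Thm. 10.2] -/
theorem abs_integral_inner_convect_laplacian_le_of_strain {u : E → E} {v : E → E'}
    (hu : HasBoundedDerivs u) (hdiv : VectorCalculus.IsDivFree u) (hv : IsSmoothL2Field v) {σ : ℝ}
    (hσ : ∀ x ξ : E, |⟪fderiv ℝ u x ξ, ξ⟫| ≤ σ * ‖ξ‖ ^ 2) :
    |∫ x, ⟪convect u v x, (Δ v) x⟫| ≤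
      σ * ∑ k, ∫ x, ‖fderiv ℝ v x (stdOrthonormalBasis ℝ E k)‖ ^ 2 := by
  set b := stdOrthonormalBasis ℝ E with hb
  obtain ⟨M₁, hM₁⟩ := hu.exists_norm_fderiv_le
  have hu1 : ContDiff ℝ 1 u := hu.contDiff_nat 1
  have hv2 : ContDiff ℝ 2 v := hv.contDiff_nat 2
  rw [integral_inner_convect_laplacian_eq_neg_sum hu hdiv hv, abs_neg]
  -- each summand is integrable
  have hi : ∀ k, Integrable
      (fun x => ⟪fderiv ℝ v x (fderiv ℝ u x (b k)), fderiv ℝ v x (b k)⟫) volume := by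
    intro k
    have hm : MemLp (fun x => fderiv ℝ v x (fderiv ℝ u x (b k))) 2 volume := by
      refine MemLp.of_le_mul (c := M₁) (memLp_fderiv_two hv) ?_ (Eventually.of_forall fun x => ?_)
      · exact ((hv2.continuous_fderiv (by norm_num)).clm_apply
          ((hu1.continuous_fderiv one_ne_zero).clm_apply continuous_const)).aestronglyMeasurable
      · calc ‖fderiv ℝ v x (fderiv ℝ u x (b k))‖ ≤ ‖fderiv ℝ v x‖ * ‖fderiv ℝ u x (b k)‖ :=
            ContinuousLinearMap.le_opNorm _ _
          _ ≤ ‖fderiv ℝ v x‖ * (‖fderiv ℝ u x‖ * ‖b k‖) := by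
            gcongr; exact ContinuousLinearMap.le_opNorm _ _
          _ ≤ M₁ * ‖fderiv ℝ v x‖ := by
            rw [b.orthonormal.1 k, mul_one, mul_comm]
            exact mul_le_mul_of_nonneg_right (hM₁ x) (norm_nonneg _)
    exact integrable_inner_of_memLp_two hm ((hv.fderiv_apply (b k)).memLp_two)
  have hsq : ∀ k, Integrable (fun x => ‖fderiv ℝ v x (b k)‖ ^ 2) volume := by
    intro k
    have := integrable_inner_of_memLp_two ((hv.fderiv_apply (b k)).memLp_two)
      ((hv.fderiv_apply (b k)).memLp_two)
    exact this.congr (Eventually.of_forall fun x => by simp only [real_inner_self_eq_norm_sq])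
  rw [← integral_finsetSum _ fun k _ => hi k, ← integral_finsetSum _ fun k _ => hsq k,
    ← integral_const_mul]
  refine (abs_integral_le_integral_abs).trans
    (integral_mono_of_nonneg (Eventually.of_forall fun x => abs_nonneg _)
      ((integrable_finsetSum _ fun k _ => hsq k).const_mul σ) (Eventually.of_forall fun x => ?_))
  -- pointwise: the linear-algebra lemma with `A = Du(x)`, `T = Dv(x)`
  exact abs_sum_inner_comp_le_of_quadForm_le b (fderiv ℝ u x) (fderiv ℝ v x) (hσ x)

end LevelOne

end Summit.NavierStokesRegularity.NavierStokesRegularity.Theorems.StrainPairing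

end
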